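import Summits.Ventures.Crystal3D.Bulk.TopCutInstance
import Summits.Ventures.Crystal3D.TopCut.T13c1299Proof
import HarnessLib

/-!
# The UNCONDITIONAL kernel cut from the prize certificate `T13(58.6946°)`: `NoHole 0.559` (ρ* < 56.0134°)

HONEST FRAMING. Part of the venture `Summits/Ventures/Crystal3D` (cell `pub-crystal3d`, phase 2; seat
typer-bulk). Composition of two tree theorems, nothing else: seat p2 (g7)'s kernel-checked
Bachoc–Vallentin certificate `T13(arccos(1299/2500))` = `T13(58.6946°)` — the sprint's PRIZE top cut —
`TopCut.T13c1299.sphereCodeBoundInner_1299_2500 : SphereCodeBoundInner (1299/2500)` (file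
`TopCut/T13c1299Proof.lean`, standard axioms, kernel `decide`). Composition with
this seat's `noHole_0559_of_sphereCodeBoundInner` (`Bulk/TopCutInstance.lean`, the PROVED polar
contraction at `λ = 9783/10000`, `ρ₀ = 0.9775` rad). Results, NO hypothesis, standard axioms:

* **`noHole_0559 : NoHole 0.559`** — the extremal hole radius of the sprint's (AG) problem is
  `< arccos 0.559 = 56.0134°` (the lead's operational top of the census window `W`, 20:47:24Z);
* `gapTupleDiam_1118 : GapTupleDiam 1.118`;
* `noHole_063_of_window_1118 : ExtremalFreeWindow 1.118 1.26 → NoHole 0.63` — GAP(1.26) ⇐ the census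
  of `W` = hole radii `[50.949877°, 56.0134°]` ALONE, with a KERNEL top; census and bulk forms.
-/

noncomputable section

namespace Summit.Ventures.Crystal3D

open Literature.Geometry.DiscreteGeometry

/-- **UNCONDITIONAL KERNEL CUT**: `NoHole 0.559` (ρ* < 56.0134°). Standard axioms; no hypothesis. -/
theorem noHole_0559 : NoHole 0.559 :=
  noHole_0559_of_sphereCodeBoundInner TopCut.T13c1299.sphereCodeBoundInner_1299_2500

/-- Fourteen-ball form, UNCONDITIONAL: `GapTupleDiam 1.118`. -/
theorem gapTupleDiam_1118 : GapTupleDiam 1.118 :=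
  gapTupleDiam_of_noHole (by rw [show (1.118 : ℝ) / 2 = 0.559 by norm_num]; exact noHole_0559)

/-- **GAP(1.26) ⇐ the census of `W = [50.949877°, 56.0134°]` ALONE**:
`ExtremalFreeWindow 1.118 1.26 → NoHole 0.63`. -/
theorem noHole_063_of_window_1118 (hwin : ExtremalFreeWindow 1.118 1.26) : NoHole 0.63 :=
  noHole_063_of_topCut_of_window TopCut.T13c1299.sphereCodeBoundInner_1299_2500 hwin

/-- The same with the census in schema form. -/
theorem noHole_063_of_census_1118 (S : GapCensus) (hC : S.CompleteReducedOn 1.118 1.26)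
    (hK : S.AllKilled) : NoHole 0.63 :=
  noHole_063_of_window_1118 (S.extremalFreeWindow hC hK)

/-- **… ⇒ bulk crystallization `K = 702`**, the classification a hypothesis (standard axioms). -/
theorem bulkCrystallization3D_sharp_of_window_1118_of_classification
    (hwin : ExtremalFreeWindow 1.118 1.26) (hcl : Hales2012_kissingConfigCongruent) :
    BulkCrystallization3D 702 :=
  bulkCrystallization3D_sharp_of_topCut_of_window_of_classification
    TopCut.T13c1299.sphereCodeBoundInner_1299_2500 hwin hcl

end Summit.Ventures.Crystal3D

end
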